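import Summits.NavierStokesRegularity.NavierStokesRegularity.Theses.LevelSetModeration

/-!
# Moderation identity (route LevelSetModeration, item stmt-NavierStokesRegularity-18152)

For a `C¹` divergence-free field `u` on `ℝ³` whose super-level set `{c < |u|}` (`c > 0`) is
bounded, and a continuous `g : ℝ → ℝ`,

  `∫ 1_{|u|>c} g(|u|) (c/|u|²) D|u|(x)(u x) dx = 0`.

On `{c < |u|}` the integrand is `u·∇(G∘|u|)` with `G(σ) = ∫_c^σ g(τ) c/τ² dτ`, and
`∫ u·∇θ = -∫ θ div u = 0` for every compactly supported `C¹` moderator `θ` (whole-space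
integration by parts, coordinatewise from Mathlib's
`integral_bilinear_hasFDerivAt_right_eq_neg_left_of_integrable`, exactly as in the tree's
`Literature.Analysis.FluidPDE.VectorCalculus.IsDivFree.isWeaklyDivFree_holds`). The kink of `G` at
the level `σ = c` (where `G' ` jumps from `0` to `g(c)/c`) is removed by the cut-offs
`ρₙ(σ) = min 1 (max 0 (n(σ - c)))`: each moderator `ρₙ g` gives the identity exactly, and dominated
convergence (`ρₙ(|u|) → 1` on `{c < |u|}`, integrand continuous on the compact closure of
`{c < |u|}`) passes to the limit. This is Tran–Yu pressure moderation `p ↦ p + Φ(|u|)` in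
De Giorgi (level-set) form (TranYu2016; Tran–Yu–Dritschel, JFM 2021).

Imports: only the route file (its closure already contains `Literature.Analysis.FluidPDE.VectorCalculus`);
`Literature.Analysis.FluidPDE.WholeSpaceIBP` is deliberately not imported, to keep the route's module cone
free of the Littlewood–Paley / Besov files it would pull in.
-/

noncomputable section

open MeasureTheory Set Filter Topology
open scoped RealInnerProductSpace

-- single-conjunct summit: `Summit.<Summit>.<Problem>` repeats the name by the D-0017 layout
set_option linter.dupNamespace false

namespace Summit.NavierStokesRegularity.NavierStokesRegularity.Theorems

open Literature.Analysis.FluidPDE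

/-- **Whole-space integration by parts against a divergence-free field.** For
`u ∈ C¹(ℝ³; ℝ³)` with `div u = 0` and a compactly supported `θ ∈ C¹(ℝ³)`,
`∫ Dθ(x)(u(x)) dx = 0`: expand `Dθ(x)(u x) = ∑ᵢ ⟪bᵢ, u x⟫ ∂ᵢθ(x)` in an orthonormal frame,
integrate by parts coordinatewise (Mathlib's
`integral_bilinear_hasFDerivAt_right_eq_neg_left_of_integrable`) and use `∑ᵢ ⟪bᵢ, Du bᵢ⟫ = div u = 0`
(the argument of `Literature.Analysis.FluidPDE.VectorCalculus.IsDivFree.isWeaklyDivFree_holds`, for a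
`C¹` rather than smooth test function). [folklore] -/
theorem levelSetModeration_integral_fderiv_apply_eq_zero
    {u : EuclideanSpace ℝ (Fin 3) → EuclideanSpace ℝ (Fin 3)} {θ : EuclideanSpace ℝ (Fin 3) → ℝ}
    (hu : ContDiff ℝ 1 u) (hdiv : VectorCalculus.IsDivFree u) (hθ : ContDiff ℝ 1 θ)
    (hθc : HasCompactSupport θ) : ∫ x, fderiv ℝ θ x (u x) = 0 := by
  set b := stdOrthonormalBasis ℝ (EuclideanSpace ℝ (Fin 3))
  have huc : Continuous u := hu.continuous
  have hDu : Continuous (fderiv ℝ u) := hu.continuous_fderiv one_ne_zero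
  have hθcont : Continuous θ := hθ.continuous
  have hDθ : Continuous (fderiv ℝ θ) := hθ.continuous_fderiv one_ne_zero
  -- pointwise expansion in the orthonormal frame `b`
  have hexp : ∀ x, fderiv ℝ θ x (u x) = ∑ i, ⟪b i, u x⟫ * fderiv ℝ θ x (b i) := by
    intro x
    conv_lhs => rw [← b.sum_repr' (u x)]
    simp only [map_sum, map_smul, smul_eq_mul]
  -- integrability of the three products (continuous × compactly supported)
  have hI1 : ∀ i, Integrable (fun x => ⟪b i, fderiv ℝ u x (b i)⟫ * θ x)
      (volume : Measure (EuclideanSpace ℝ (Fin 3))) :=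
    fun i => ((continuous_const.inner (hDu.clm_apply continuous_const)).mul hθcont)
      |>.integrable_of_hasCompactSupport hθc.mul_left
  have hI2 : ∀ i, Integrable (fun x => ⟪b i, u x⟫ * fderiv ℝ θ x (b i))
      (volume : Measure (EuclideanSpace ℝ (Fin 3))) :=
    fun i => ((continuous_const.inner huc).mul (hDθ.clm_apply continuous_const))
      |>.integrable_of_hasCompactSupport (hθc.fderiv_apply (𝕜 := ℝ) (b i)).mul_left
  have hI3 : ∀ i, Integrable (fun x => ⟪b i, u x⟫ * θ x)
      (volume : Measure (EuclideanSpace ℝ (Fin 3))) :=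
    fun i => ((continuous_const.inner huc).mul hθcont).integrable_of_hasCompactSupport hθc.mul_left
  -- integration by parts, one coordinate at a time
  have hibp : ∀ i, ∫ x, ⟪b i, u x⟫ * fderiv ℝ θ x (b i) =
      -∫ x, ⟪b i, fderiv ℝ u x (b i)⟫ * θ x := by
    intro i
    have h := integral_bilinear_hasFDerivAt_right_eq_neg_left_of_integrable
      (μ := (volume : Measure (EuclideanSpace ℝ (Fin 3))))
      (f := u) (f' := fderiv ℝ u) (g := θ) (g' := fderiv ℝ θ) (v := b i)
      (B := (ContinuousLinearMap.mul ℝ ℝ).comp (innerSL ℝ (b i)))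
      (by simpa using hI1 i) (by simpa using hI2 i) (by simpa using hI3 i)
      (fun x _ => (hu.differentiable one_ne_zero x).hasFDerivAt)
      (fun x _ => (hθ.differentiable one_ne_zero x).hasFDerivAt)
    simpa using h
  calc ∫ x, fderiv ℝ θ x (u x)
      = ∫ x, ∑ i, ⟪b i, u x⟫ * fderiv ℝ θ x (b i) := by simp_rw [hexp]
    _ = ∑ i, ∫ x, ⟪b i, u x⟫ * fderiv ℝ θ x (b i) := integral_finsetSum _ fun i _ => hI2 i
    _ = -∫ x, ∑ i, ⟪b i, fderiv ℝ u x (b i)⟫ * θ x := by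
      rw [integral_finsetSum _ fun i _ => hI1 i, ← Finset.sum_neg_distrib]
      exact Finset.sum_congr rfl fun i _ => hibp i
    _ = 0 := by
      have hdiv' : ∀ x, ∑ i, ⟪b i, fderiv ℝ u x (b i)⟫ = 0 := fun x =>
        (divergence_eq_sum_inner_fderiv b u x).symm.trans (hdiv x)
      simp_rw [← Finset.sum_mul, hdiv', zero_mul, integral_zero, neg_zero]

/-- **Exact moderation identity for moderators vanishing at the level.** For `u ∈ C¹(ℝ³; ℝ³)`
divergence free with `{c < |u|}` bounded (`c > 0`) and a continuous `h : ℝ → ℝ` vanishing on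
`(-∞, c]`, `∫ h(|u x|) D|u|(x)(u x) dx = 0`. With `G(σ) = ∫_c^σ h` (a `C¹` primitive, `G = 0` on
`(-∞, c]`) the moderator `θ = G ∘ |u|` is `C¹` (chain rule where `u ≠ 0`, identically zero on the
open set `{|u| < c} ⊇ {u = 0}`), is supported in the compact closure of `{c < |u|}`, and satisfies
`Dθ(x)(u x) = h(|u x|) D|u|(x)(u x)`; conclude by
`levelSetModeration_integral_fderiv_apply_eq_zero`. [folklore] -/
theorem levelSetModeration_integral_comp_norm_mul_fderiv_norm_eq_zero
    {u : EuclideanSpace ℝ (Fin 3) → EuclideanSpace ℝ (Fin 3)} {c : ℝ} (hc : 0 < c)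
    (hu : ContDiff ℝ 1 u) (hdiv : VectorCalculus.IsDivFree u)
    (hbdd : Bornology.IsBounded {x | c < ‖u x‖}) {h : ℝ → ℝ} (hh : Continuous h)
    (hh0 : ∀ τ ≤ c, h τ = 0) :
    ∫ x, h ‖u x‖ * fderiv ℝ (fun y => ‖u y‖) x (u x) = 0 := by
  -- the primitive `G` of `h` from `c`
  set G : ℝ → ℝ := fun σ => ∫ τ in c..σ, h τ with hG_def
  have hG : ∀ σ, HasDerivAt G (h σ) σ := fun σ => (hh.integral_hasStrictDerivAt c σ).hasDerivAt
  have hG0 : ∀ σ ≤ c, G σ = 0 := by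
    intro σ hσ
    show (∫ τ in c..σ, h τ) = 0
    rw [intervalIntegral.integral_congr (g := fun _ => (0 : ℝ)) ?_, intervalIntegral.integral_zero]
    intro τ hτ
    rw [Set.uIcc_of_ge hσ] at hτ
    exact hh0 τ hτ.2
  have hGC1 : ContDiff ℝ 1 G := by
    rw [contDiff_one_iff_deriv]
    refine ⟨fun σ => (hG σ).differentiableAt, ?_⟩
    have hderiv : deriv G = h := funext fun σ => (hG σ).deriv
    rw [hderiv]
    exact hh
  -- the moderator `θ = G ∘ |u|`
  set θ : EuclideanSpace ℝ (Fin 3) → ℝ := fun x => G ‖u x‖ with hθ_def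
  have hs_at : ∀ x, u x ≠ 0 → ContDiffAt ℝ 1 (fun y => ‖u y‖) x := fun x hx =>
    hu.contDiffAt.norm ℝ hx
  -- `θ` is `C¹`: chain rule where `u ≠ 0`, identically zero near `{u = 0}` (as `0 < c`)
  have hθC1 : ContDiff ℝ 1 θ := by
    rw [contDiff_iff_contDiffAt]
    intro x
    by_cases hx : u x = 0
    · have hU : IsOpen {y : EuclideanSpace ℝ (Fin 3) | ‖u y‖ < c} :=
        isOpen_lt hu.continuous.norm continuous_const
      have hxU : x ∈ {y : EuclideanSpace ℝ (Fin 3) | ‖u y‖ < c} := by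
        simp only [mem_setOf_eq, hx, norm_zero, hc]
      have hev : θ =ᶠ[𝓝 x] fun _ => 0 :=
        Filter.eventuallyEq_of_mem (hU.mem_nhds hxU) fun y hy => hG0 _ (le_of_lt hy)
      exact (contDiffAt_const (c := (0 : ℝ))).congr_of_eventuallyEq hev
    · exact hGC1.contDiffAt.comp x (hs_at x hx)
  -- `θ` is supported in the compact closure of `{c < |u|}`
  have hθc : HasCompactSupport θ := by
    refine HasCompactSupport.intro hbdd.isCompact_closure fun x hx => ?_
    have hx' : ¬ c < ‖u x‖ := fun h' => hx (subset_closure h')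
    exact hG0 _ (not_lt.1 hx')
  -- chain rule: `Dθ(x)(u x) = h(|u x|) · D|u|(x)(u x)`
  have hchain : ∀ x, fderiv ℝ θ x (u x) = h ‖u x‖ * fderiv ℝ (fun y => ‖u y‖) x (u x) := by
    intro x
    by_cases hx : u x = 0
    · simp [hx]
    · have hd : DifferentiableAt ℝ (fun y => ‖u y‖) x :=
        (hs_at x hx).differentiableAt one_ne_zero
      have hcomp := (hG ‖u x‖).comp_hasFDerivAt x hd.hasFDerivAt
      rw [show θ = G ∘ fun y => ‖u y‖ from rfl, hcomp.fderiv]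
      simp [smul_eq_mul]
  have h0 := levelSetModeration_integral_fderiv_apply_eq_zero hu hdiv hθC1 hθc
  simpa only [hchain] using h0

/-- **Moderation identity** (item stmt-NavierStokesRegularity-18152 of route LevelSetModeration;
Tran–Yu pressure moderation in De Giorgi form): for a `C¹` divergence-free field `u` on `ℝ³` with
bounded super-level set `{c < |u|}` (`c > 0`) and continuous `g`,
`∫ 1_{|u|>c} g(|u|) (c/|u|²) D|u|(x)(u x) dx = 0`.
Proof: with the cut-offs `ρₙ(σ) = min 1 (max 0 (n(σ - c)))` the moderators
`hₙ(σ) = ρₙ(σ) g(σ) c / max(σ, c/2)²` are continuous on `ℝ` and vanish on `(-∞, c]`, and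
`hₙ(|u|) D|u|(u) = ρₙ(|u|) · 1_{|u|>c} g(|u|) (c/|u|²) D|u|(u)` pointwise, so each cut-off
integral vanishes exactly (`levelSetModeration_integral_comp_norm_mul_fderiv_norm_eq_zero`);
`ρₙ(|u|) → 1` on `{c < |u|}`, `0 ≤ ρₙ ≤ 1`, and the integrand is integrable (continuous on the
compact closure of `{c < |u|}`, where `|u| ≥ c > 0`), so dominated convergence gives the
claim. -/
theorem levelSetModeration_moderationIdentity_proof :
    Summit.NavierStokesRegularity.NavierStokesRegularity.Theses.LevelSetModeration.ModerationIdentity := by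
  intro u g c hc hu hdiv hg hbdd
  set A : Set (EuclideanSpace ℝ (Fin 3)) := {x | c < ‖u x‖} with hA_def
  set f : EuclideanSpace ℝ (Fin 3) → ℝ :=
    fun x => g ‖u x‖ * (c / ‖u x‖ ^ 2) * fderiv ℝ (fun y => ‖u y‖) x (u x) with hf_def
  -- Step 1: the integrand `1_A f` is integrable (continuous on the compact closure of `A`)
  have hA_open : IsOpen A := isOpen_lt continuous_const hu.continuous.norm
  have hK : IsCompact (closure A) := hbdd.isCompact_closure
  have hKsub : closure A ⊆ {x | c ≤ ‖u x‖} :=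
    closure_minimal (fun x (hx : c < ‖u x‖) => show c ≤ ‖u x‖ from le_of_lt hx)
      (isClosed_le continuous_const hu.continuous.norm)
  have hs_at : ∀ x, u x ≠ 0 → ContDiffAt ℝ 1 (fun y => ‖u y‖) x := fun x hx =>
    hu.contDiffAt.norm ℝ hx
  have hf_cont : ∀ x, u x ≠ 0 → ContinuousAt f x := by
    intro x hx
    have h1 : ContinuousAt (fun y => g ‖u y‖) x := (hg.comp hu.continuous.norm).continuousAt
    have h2 : ContinuousAt (fun y => c / ‖u y‖ ^ 2) x :=
      continuousAt_const.div (hu.continuous.norm.pow 2).continuousAt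
        (pow_ne_zero 2 (norm_ne_zero_iff.2 hx))
    have h3 : ContinuousAt (fderiv ℝ fun y => ‖u y‖) x :=
      ((hs_at x hx).fderiv_right (m := 0) le_rfl).continuousAt
    exact (h1.mul h2).mul (h3.clm_apply hu.continuous.continuousAt)
  have hne : ∀ x ∈ closure A, u x ≠ 0 := by
    intro x hx h0
    have hcx : c ≤ ‖u x‖ := hKsub hx
    rw [h0, norm_zero] at hcx
    exact absurd hcx (not_le.2 hc)
  have hF : Integrable (A.indicator f) := by
    refine IntegrableOn.integrable_indicator ?_ hA_open.measurableSet
    exact (ContinuousOn.integrableOn_compact hK fun x hx =>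
      (hf_cont x (hne x hx)).continuousWithinAt).mono_set subset_closure
  -- Step 2: the cut-offs `ρₙ`
  set ρ : ℕ → ℝ → ℝ := fun n σ => min 1 (max 0 (n * (σ - c))) with hρ_def
  have hρ_cont : ∀ n, Continuous (ρ n) := fun n =>
    continuous_const.min (continuous_const.max (continuous_const.mul
      (continuous_id.sub continuous_const)))
  have hρ_nonneg : ∀ n σ, 0 ≤ ρ n σ := fun n σ => le_min zero_le_one (le_max_left _ _)
  have hρ_le_one : ∀ n σ, ρ n σ ≤ 1 := fun n σ => min_le_left _ _
  have hρ_zero : ∀ n σ, σ ≤ c → ρ n σ = 0 := by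
    intro n σ hσ
    have hnp : (n : ℝ) * (σ - c) ≤ 0 :=
      mul_nonpos_of_nonneg_of_nonpos n.cast_nonneg (sub_nonpos.2 hσ)
    show min 1 (max 0 ((n : ℝ) * (σ - c))) = 0
    rw [max_eq_left hnp, min_eq_right zero_le_one]
  have hρ_lim : ∀ σ, c < σ → Tendsto (fun n => ρ n σ) atTop (𝓝 1) := by
    intro σ hσ
    obtain ⟨N, hN⟩ := exists_nat_gt (σ - c)⁻¹
    refine tendsto_const_nhds.congr' (eventually_atTop.2 ⟨N, fun n hn => ?_⟩)
    have hσc : 0 < σ - c := sub_pos.2 hσ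
    have h1 : 1 ≤ (n : ℝ) * (σ - c) := by
      have hNn : (σ - c)⁻¹ ≤ n := hN.le.trans (Nat.cast_le.2 hn)
      calc (1 : ℝ) = (σ - c)⁻¹ * (σ - c) := by field_simp
        _ ≤ n * (σ - c) := mul_le_mul_of_nonneg_right hNn hσc.le
    show (1 : ℝ) = min 1 (max 0 ((n : ℝ) * (σ - c)))
    rw [min_eq_left (le_max_of_le_right h1)]
  -- the moderators `hₙ(τ) = ρₙ(τ) g(τ) c / max(τ, c/2)²`, continuous on `ℝ`, zero on `(-∞, c]`
  set hmod : ℕ → ℝ → ℝ := fun n τ => ρ n τ * (g τ * (c / (max τ (c / 2)) ^ 2)) with hmod_def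
  have hmod_cont : ∀ n, Continuous (hmod n) := by
    intro n
    refine (hρ_cont n).mul (hg.mul (continuous_const.div
      ((continuous_id.max continuous_const).pow 2) fun τ => ?_))
    exact pow_ne_zero 2 (ne_of_gt (lt_of_lt_of_le (half_pos hc) (le_max_right _ _)))
  have hmod_zero : ∀ n τ, τ ≤ c → hmod n τ = 0 := by
    intro n τ hτ
    show ρ n τ * (g τ * (c / (max τ (c / 2)) ^ 2)) = 0
    rw [hρ_zero n τ hτ, zero_mul]
  -- pointwise: `hₙ(|u|) D|u|(u) = ρₙ(|u|) · 1_A f`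
  have hpt : ∀ n x, hmod n ‖u x‖ * fderiv ℝ (fun y => ‖u y‖) x (u x) =
      ρ n ‖u x‖ * A.indicator f x := by
    intro n x
    by_cases hx : x ∈ A
    · have hx' : c < ‖u x‖ := hx
      rw [indicator_of_mem hx]
      have hmax : max ‖u x‖ (c / 2) = ‖u x‖ := max_eq_left (by linarith)
      show ρ n ‖u x‖ * (g ‖u x‖ * (c / (max ‖u x‖ (c / 2)) ^ 2)) *
          fderiv ℝ (fun y => ‖u y‖) x (u x) =
        ρ n ‖u x‖ * (g ‖u x‖ * (c / ‖u x‖ ^ 2) * fderiv ℝ (fun y => ‖u y‖) x (u x))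
      rw [hmax]
      ring
    · have hx' : ‖u x‖ ≤ c := not_lt.1 hx
      rw [indicator_of_notMem hx, hmod_zero n _ hx', hρ_zero n _ hx']
      ring
  -- Step 3: each cut-off integral vanishes exactly
  have hzero : ∀ n, ∫ x, ρ n ‖u x‖ * A.indicator f x = 0 := by
    intro n
    have h0 := levelSetModeration_integral_comp_norm_mul_fderiv_norm_eq_zero hc hu hdiv hbdd
      (hmod_cont n) (hmod_zero n)
    simpa only [hpt] using h0
  -- Step 4: dominated convergence, dominated by `|1_A f|`
  have hlim : Tendsto (fun n => ∫ x, ρ n ‖u x‖ * A.indicator f x) atTop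
      (𝓝 (∫ x, A.indicator f x)) := by
    refine tendsto_integral_of_dominated_convergence (fun x => ‖A.indicator f x‖)
      (fun n => ((hρ_cont n).comp hu.continuous.norm).aestronglyMeasurable.mul
        hF.aestronglyMeasurable) hF.norm ?_ ?_
    · intro n
      refine Eventually.of_forall fun x => ?_
      rw [norm_mul]
      refine mul_le_of_le_one_left (norm_nonneg _) ?_
      rw [Real.norm_eq_abs, abs_of_nonneg (hρ_nonneg n _)]
      exact hρ_le_one n _
    · refine Eventually.of_forall fun x => ?_
      by_cases hx : x ∈ A
      · have hx' : c < ‖u x‖ := hx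
        have := (hρ_lim ‖u x‖ hx').mul_const (A.indicator f x)
        simpa using this
      · simp [indicator_of_notMem hx]
  have hlim' : Tendsto (fun n : ℕ => ∫ x, ρ n ‖u x‖ * A.indicator f x) atTop (𝓝 0) := by
    simp only [hzero]
    exact tendsto_const_nhds
  exact tendsto_nhds_unique hlim hlim'

end Summit.NavierStokesRegularity.NavierStokesRegularity.Theorems
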